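import Summits.Ventures.PackingBounds.Energy.FivePointRieszEightGramDataE1
import Summits.Ventures.PackingBounds.Energy.FivePointRieszEightGramDataE2
import Summits.Ventures.PackingBounds.Energy.FivePointRieszEightGramDataE3
import Summits.Ventures.PackingBounds.Energy.FivePointRieszEightGramDataE4
import HarnessLib

/-!
# Integer Gram data `S·Y = L Lᵀ + E` (the rows of E: the table (collector of 4 part modules)) of the 158 × 158 SOS block of the exact sharp three-point certificate
# `e3pt-sharp-n3N5s8d8-none.json` (triangular bipyramid; five points on S², single SOS term, d = 8)

Framing: lottery ticket; floor = certified bounds/negative ranges. Venture `PackingBounds`, cell `pub-packcert`, energy family E3PT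
(pub-packcert-energy gen 15; KERNEL-D6 data route). `yR8` = S·Y (S = `scaleR8` = lcm of denominators · 2^40), `lR8` = rounded scaled Cholesky
factor, `eR8` = S·Y − lR8·lR8ᵀ (exact; symmetric, diagonally dominant). Checked by `decide +kernel` with `GramData.checkRows` / `checkDD`
in `FivePointRieszEightGramFacts*`; generator `pub-packcert-energy/code/e3pt/g17/e3pt_lean_n3x.py`. (Rows split in independent modules for the gate's request-size limit; one collector per table.)
-/

namespace Summit.Ventures.PackingBounds.Energy.RieszEightD8

/-- data rows. -/
def eR8 : List (List ℤ) := [eR80, eR81, eR82, eR83, eR84, eR85, eR86, eR87, eR88, eR89, eR810, eR811, eR812, eR813, eR814, eR815, eR816, eR817, eR818, eR819, eR820, eR821, eR822, eR823, eR824, eR825, eR826, eR827, eR828, eR829, eR830, eR831, eR832, eR833, eR834, eR835, eR836, eR837, eR838, eR839, eR840, eR841, eR842, eR843, eR844, eR845, eR846, eR847, eR848, eR849, eR850, eR851, eR852, eR853, eR854, eR855, eR856, eR857, eR858, eR859, eR860, eR861, eR862, eR863, eR864, eR865, eR866, eR867, eR868, eR869, eR870, eR871, eR872, eR873, eR874,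 eR875, eR876, eR877, eR878, eR879, eR880, eR881, eR882, eR883, eR884, eR885, eR886, eR887, eR888, eR889, eR890, eR891, eR892, eR893, eR894, eR895, eR896, eR897, eR898, eR899, eR8100, eR8101, eR8102, eR8103, eR8104, eR8105, eR8106, eR8107, eR8108, eR8109, eR8110, eR8111, eR8112, eR8113, eR8114, eR8115, eR8116, eR8117, eR8118, eR8119, eR8120, eR8121, eR8122, eR8123, eR8124, eR8125, eR8126, eR8127, eR8128, eR8129, eR8130, eR8131, eR8132, eR8133, eR8134, eR8135, eR8136, eR8137, eR8138, eR8139, eR8140, eR8141, eR8142, eR8143, eR8144, eR8145, eR8146, eR8147, eR8148, eR8149, eR8150, eR8151, eR8152, eR8153, eR8154, eR8155, eR8156, eR8157]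

end Summit.Ventures.PackingBounds.Energy.RieszEightD8
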